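import Mathlib
import HarnessLib
import Literature.Probability.MarkovChains.IsingSpectralHighTemperatureLSIProof

/-!
# The spectral high-temperature bound on the logarithmic Sobolev CONSTANT of the Ising model:
# `α ≥ (1 − β)/(1 + β)` (Bauerschmidt–Bodineau 2019 = [BBD] Theorem 10, in Saloff-Coste's normalisation)

HONEST FRAMING: discrete ±1 spins, spectral high temperature `β < 1`; a sibling-setting functional
inequality (cell ym-ir, census row B17). Nothing here concerns gauge theories.

Conventions of `LogSobolevConstant.lean` (`logSobolevConst π K = inf{𝓔_K(f)/𝓛_π(f)}`, `𝓛_π(f) = Ent_π(f²)`)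
and `IsingSpectralHighTemperatureLSI.lean` (`SpectralIsing.law`, `flipKernel`, `ent`).  The typed fact
`SpectralIsing.BauerschmidtBodineau2019_logSobolev` ([BBD] Thm 10: `Ent_μ(F) ≤ (1 + 2β/(1−β)) D_μ(√F)`) is a
THEOREM of the tree (`BauerschmidtBodineau2019_logSobolev_holds`, file `IsingSpectralHighTemperatureLSIProof`);
its docstring records the consequence "in Saloff-Coste's normalisation … `α(law, flipKernel) ≥ (1−β)/(1+β)`
(take `F = f²`, `D(|f|) ≤ D(f)`); that corollary is not restated" — it is PROVED here
(`logSobolevConst_law_ge`), since `1 + 2β/(1−β) = (1+β)/(1−β)`; with Saloff-Coste's Lemma 2.2.2 (`2α ≤ λ`,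
tree) the right spectral gap of the flip kernel is `≥ 2(1−β)/(1+β)` (`spectralGapR_law_ge`).  Theorems
only, 0 named facts.

## References
* [BauerschmidtBodineauDagallier2023] R. Bauerschmidt, T. Bodineau, B. Dagallier, Probab. Surveys 21 (2024)
  = arXiv:2307.07619, Theorem 10 (p0039 L108–118); Def 1 (p0007 L85–91, the normalisation `Ent ≤ (2/γ)D(√F)`).
* [Saloffcoste1997] L. Saloff-Coste, *Lectures on finite Markov chains*, LNM 1665 (1997), §2.2.1 Def 2.2.1.
-/

namespace Literature.Probability.MarkovChains

namespace SpectralIsing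

open Finset Matrix

variable {Λ : Type} [Fintype Λ] [DecidableEq Λ]

/-- The flip incidence matrix is entrywise non-negative. [cite: BauerschmidtBodineauDagallier2023, §2.1 (e:Dirichlet-discrete)] -/
theorem flipKernel_nonneg (σ τ : Λ → ℤˣ) : 0 ≤ flipKernel σ τ :=
  sum_nonneg fun x _ => by split_ifs <;> norm_num

/-- `D(|f|) ≤ D(f)` for the standard flip Dirichlet form of a non-negative law (`||a| − |b|| ≤ |a − b|`).
[cite: Saloffcoste1997, §2.2.1 (proof of Lemma 2.2.2: "`𝓔(|f|,|f|) ≤ 𝓔(f,f)`")] -/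
theorem dirichletForm_abs_le {π : (Λ → ℤˣ) → ℝ} (hπ : ∀ σ, 0 ≤ π σ) (f : (Λ → ℤˣ) → ℝ) :
    dirichletForm π flipKernel (fun σ => |f σ|) ≤ dirichletForm π flipKernel f := by
  unfold dirichletForm
  refine mul_le_mul_of_nonneg_left (sum_le_sum fun σ _ => sum_le_sum fun τ _ => ?_) (by norm_num)
  refine mul_le_mul_of_nonneg_left ?_ (mul_nonneg (hπ σ) (flipKernel_nonneg σ τ))
  rw [← sq_abs (|f σ| - |f τ|), ← sq_abs (f σ - f τ)]
  exact pow_le_pow_left₀ (abs_nonneg _) (abs_abs_sub_abs_le_abs_sub _ _) 2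

/-- `𝓛_π(f) = Ent_π(f²)`: Saloff-Coste's functional at `f` is [BBD]'s entropy of `F = f²`.
[cite: BauerschmidtBodineauDagallier2023, §2.1 (Def 1)] -/
theorem entForm_eq_ent_sq {π : (Λ → ℤˣ) → ℝ} (hπ : ∀ σ, 0 < π σ) (f : (Λ → ℤˣ) → ℝ) :
    entForm π f = ent π (fun σ => f σ ^ 2) := by
  rw [ent_eq_entForm_sqrt hπ (fun σ => sq_nonneg (f σ))]
  unfold entForm piInner
  simp_rw [Real.sqrt_sq_eq_abs, sq_abs, abs_mul_abs_self]

/-- **The log-Sobolev constant of the Ising model at spectral high temperature is at least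
`(1 − β)/(1 + β)`, uniformly in `Λ`, `A` (spectrum in `[0,1]`) and the field `h`** — [BBD] Theorem 10 read
in Saloff-Coste's normalisation `α = inf 𝓔(f)/𝓛(f)` for the single-spin-flip incidence kernel
(`1/(1 + 2β/(1−β)) = (1−β)/(1+β)`; `F = f²`, `D(√(f²)) = D(|f|) ≤ D(f)`).
[cite: BauerschmidtBodineauDagallier2023, Theorem 10] -/
theorem logSobolevConst_law_ge [Nonempty Λ] (A : Matrix Λ Λ ℝ) (h : Λ → ℝ) {β : ℝ}
    (hA : A.PosSemidef) (hA1 : (1 - A).PosSemidef) (hβ0 : 0 < β) (hβ1 : β < 1) :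
    (1 - β) / (1 + β) ≤ logSobolevConst (law A h β) flipKernel := by
  have hπ := law_pos A h β
  have hπ1 := sum_law A h β
  haveI : Nontrivial (Λ → ℤˣ) := by
    obtain ⟨x⟩ := ‹Nonempty Λ›
    refine ⟨⟨fun _ => 1, fun _ => -1, fun heq => ?_⟩⟩
    have := congrFun heq x
    exact absurd this (by decide)
  refine le_logSobolevConst hπ hπ1 (fun f => ?_) ?_
  · have h1 := BauerschmidtBodineau2019_logSobolev_holds Λ A h β hA hA1 hβ0 hβ1 (fun σ => f σ ^ 2)
      (fun σ => sq_nonneg _)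
    rw [← entForm_eq_ent_sq hπ] at h1
    have h2 : dirichletForm (law A h β) flipKernel (fun σ => Real.sqrt (f σ ^ 2))
        ≤ dirichletForm (law A h β) flipKernel f := by
      simp_rw [Real.sqrt_sq_eq_abs]
      exact dirichletForm_abs_le (fun σ => (hπ σ).le) f
    have hb : 0 < 1 - β := by linarith
    have hK : (1 : ℝ) + 2 * β / (1 - β) = (1 + β) / (1 - β) := by
      field_simp
      ring
    rw [hK] at h1
    have h3 : entForm (law A h β) f ≤ (1 + β) / (1 - β) * dirichletForm (law A h β) flipKernel f :=
      h1.trans (mul_le_mul_of_nonneg_left h2 (by positivity))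
    calc (1 - β) / (1 + β) * entForm (law A h β) f
        ≤ (1 - β) / (1 + β) * ((1 + β) / (1 - β) * dirichletForm (law A h β) flipKernel f) :=
          mul_le_mul_of_nonneg_left h3 (by positivity)
      _ = dirichletForm (law A h β) flipKernel f := by
          field_simp
  · obtain ⟨f, hf⟩ := exists_entForm_pos hπ hπ1
    exact ⟨f, hf.ne'⟩

/-- **Uniform spectral gap at spectral high temperature**: the right spectral gap
`Gap_R = inf{𝓔(f) : E_μ f = 0, ‖f‖_μ = 1}` of the single-spin-flip incidence kernel for the Ising law
satisfies `Gap_R ≥ 2(1 − β)/(1 + β)`, uniformly in `Λ`, `A` (spectrum in `[0,1]`) and `h` — Theorem 10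
combined with Saloff-Coste's Lemma 2.2.2 `2α ≤ λ` ([BBD] Prop. (prop:spectralgap): "the spectral gap is
always larger than the log-Sobolev constant"). [cite: BauerschmidtBodineauDagallier2023, Theorem 10]
[cite: Saloffcoste1997, §2.2.1 Lemma 2.2.2] -/
theorem spectralGapR_law_ge [Nonempty Λ] (A : Matrix Λ Λ ℝ) (h : Λ → ℝ) {β : ℝ}
    (hA : A.PosSemidef) (hA1 : (1 - A).PosSemidef) (hβ0 : 0 < β) (hβ1 : β < 1) :
    2 * ((1 - β) / (1 + β)) ≤ spectralGapR (law A h β) flipKernel :=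
  (mul_le_mul_of_nonneg_left (logSobolevConst_law_ge A h hA hA1 hβ0 hβ1) (by norm_num)).trans
    (Saloffcoste1997_lemma_2_2_2 (law_pos A h β) (sum_law A h β) flipKernel_nonneg)

end SpectralIsing

end Literature.Probability.MarkovChains
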